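import Literature.MathematicalPhysics.QuantumFieldTheory.Balaban1983to89.B1TorusCubeCover
import Literature.MathematicalPhysics.QuantumFieldTheory.Balaban1983to89.HiggsCovariancePos
import Literature.MathematicalPhysics.QuantumFieldTheory.Balaban1983to89.B4Eq212SupNeumann

/-!
# `Balaban1983to89.B1TorusCubeLocality26` — [Balaban1983RegularityDecay] §2 pp. 575–577 ON THE TORUS `Ω = T_ε` FOR THE
# (Higgs)₂,₃ COVARIANCE OPERATOR OF [Balaban1982Higgs1] (2.20): the cube configurations «Ã_j = A₀ + θ_jA′», the locality
# identity **(2.6)** «Δ(A)(h_jψ) = Δ_{□_j}(Ã_j)(h_jψ)» (here for the full operator `−Δ^{ε,N}_{A} + m² + a_K(L^Kε)^{−2}P_K(A)`),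
# the row support of «K_j = [Δ_{□_j}(Ã_j), h_j]», and THEOREM (1.10) (value member, sup form) on the torus MODULO the
# per-cube inputs (2.17), (2.20) — by instantiating the abstract (2.9)–(2.12) of `B4Eq212SupNeumann`

statement-level skeleton of published theorems with citation tags; proofs where landed; nothing here is a claim about the Yang–Mills mass gap

CITATION HEADER (lean-in-tree rule).  T. Bałaban, *Regularity and decay of lattice Green's functions*, Commun. Math. Phys.
**89** (1983) 571–597 [Balaban1983RegularityDecay] (cell paper B4; held text `paper:balaban1983-cmp89-regularity-decay`,
journal page = PDF page + 570; pp. 573, 575–577 read by this seat) and T. Bałaban, *(Higgs)₂,₃ quantum fields in a finite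
volume. I*, Commun. Math. Phys. **85** (1982) 603–626 [Balaban1982Higgs1] ((2.17), (2.20) p. 610: the operator; Prop. 2.1
(2.25) p. 611: the consumer).  Cell `lit-balaban` (HOME `run/shared/lean/pub/lit-balaban/`), Phase-2 proof seat **p35** gen 8
(unit `lit-balaban-p35`); SKELETON rows **B4.Eq2.6**, **B4.Eq2.7/2.8** (K_j), **B4.Thm@573**/(1.10) value member and
**B1.Prop2.1**/(2.25) sup clause on `Ω = T_ε` (consumer: the scalar half `hGs` of the B1.Thm@606 model ledger,
`B1Ineq367SmallFieldTorus`).  USED BY NAME, never restated: the typer's `HiggsCovariance.{covLaplacianN, fwdTerm, bwdTerm,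
avgQkLin, avgQkAdj, projPk, covOpK, propagatorK}`, `HiggsCovariancePos.{isUnit_covOpK, covOpK_mul_propagatorK}`, p23's
`B2Ineq329PrismHolonomy.{abs_multiContourSum_le, blockIter_stair_src, multiContourSum_sub}`, this seat's `B1TorusCubeCover`
(cubes, `hTor`, `thetaTor`, multiplicity) and `B4Eq212SupNeumann.norm_inverse_apply_le_of_isUnit` ((2.9)–(2.12)).

WHAT IS PRINTED (pp. 575–577, verbatim up to OCR).  *«… if □_j is an interior cube of Ω, then we take Ã_j as equal to A on
the cube {x : |x − Mj| ≤ ¾M}, and changing regularly to a constant function in a neighbourhood of a boundary of □_j. … A =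
A₀ + A′, where A₀ is a constant configuration, e.g. A₀ = A(Mj) … Ã_j = A₀ + θ_jA′. … Let us calculate (−Δ + m² + aP)G₀. We
have Δ_Ω(A)(h_jψ) = Δ_{□_j}(Ã_j)(h_jψ) (2.6) … K_j is determined by the formula (2.7) … R = −Σ_j K_jG_{k,j}(□_j, Ã_j)h_j (2.8)
… G_k(Ω,A) = G₀(I − R)^{−1} = Σ_{n≥0} G₀Rⁿ (2.10) … |G₀(x,y)| ≤ … (2.11) … |R(x,y)| ≤ … (2.12).»*  On the torus every cube
is interior, so `Ã_j = A₀ + θ_jA′` for every `j`.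

WHAT THIS FILE PROVES (kernel-checked, zero `sorry`; two definitions with bodies + theorems; no `def … : Prop` fact).
* §1 `rS` (the row radius `⌊⅝M⌋ + L^K`) and its arithmetic under `K₀ ≥ 8` (`four_rS_le`, `rS_succ_lt_half`).
* §2 `cornerSite` (`Mj − M`), **`cubeVec`** (`Ã_j(b) = A_ν(Mj−M) + θ_j(b₋)(A(b) − A_ν(Mj−M))`, `ν` the direction of `b`): `= A` where
  `θ_j(b₋) = 1`; **`multiContourSum_cubeVec`**: `Ã_j(Γ^{(K)}_{y,x}) = A(Γ^{(K)}_{y,x})` whenever `θ_j = 1` on the `K`-block of `x`.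
* §3 pointwise formulas `fwdTerm_apply`, `bwdTerm_apply`, `covLaplacianN_apply`, `projPk_apply`.
* §4 **(2.6) on the torus**: `covOpK_hTor_agree` — `(−Δ^{ε,N}_{A,T} + m² + a_K(L^Kε)^{−2}P_K(A))(h_jψ) =
  (−Δ^{ε,N}_{Ã_j,□_j} + m² + a_K(L^Kε)^{−2}P_K(Ã_j))(h_jψ)` for every `A`, `ψ`, `j` (`K ≤ K_P`, `K₀ ∣ M_P`, `K₀ ≥ 8`).
* §5 **row support of `K_j`**: `commutator_row_zero` — off `S_j = {|x − Mj| ≤ rS}` the field `H_j(h_jθ) − h_jH_jθ` vanishes.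
* §6 **THEOREM (1.10), value member, sup form, on `T_ε`, modulo the cube inputs**: `norm_propagatorK_univ_le` — if every
  cube Green's function satisfies `‖G_j(h_jψ)‖_∞ ≤ γ‖ψ‖_∞` ((2.17)/(2.20) first factor) and `‖K_jG_j(h_jψ)‖_∞ ≤ β‖ψ‖_∞`
  ((2.20)) with `2^dβ ≤ ½`, then `‖G^ε_K(T_ε, A)φ‖_∞ ≤ 2·2^d·γ‖φ‖_∞` (`m² > 0`, `a_K ≥ 0`).
HONEST SCOPE.  The per-cube inputs γ, β are HYPOTHESES here (they are [B4] Lemma 2.2 on a cube, supplied from the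
lineage's box theorems by the dictionary file of this programme); no decay statement; `Ω = T_ε` only.  Unit
`lit-balaban-p35` gen 8 (literature-prover-lit-balaban-p35-g8-0).
-/

open scoped BigOperators

noncomputable section

namespace Literature.MathematicalPhysics.QuantumFieldTheory.Balaban1983to89.B1TorusCubeLocality26

open Literature.MathematicalPhysics.QuantumFieldTheory.Balaban1983to89.HiggsLattice
open Literature.MathematicalPhysics.QuantumFieldTheory.Balaban1983to89.HiggsAveraging
open Literature.MathematicalPhysics.QuantumFieldTheory.Balaban1983to89.HiggsCovariance
open Literature.MathematicalPhysics.QuantumFieldTheory.Balaban1983to89.HiggsCovariancePos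
  (shift_unshift unshift_shift isUnit_covOpK covOpK_mul_propagatorK)
open Literature.MathematicalPhysics.QuantumFieldTheory.Balaban1983to89.B2Ineq329PrismHolonomy
  (abs_multiContourSum_le blockIter_stair_src multiContourSum_sub)
open Literature.MathematicalPhysics.QuantumFieldTheory.Balaban1983to89.B1TorusCubeCover
open Literature.MathematicalPhysics.QuantumFieldTheory.Balaban1983to89.B4Eq212SupNeumann
  (norm_inverse_apply_le_of_isUnit)

variable {P : HiggsLattice.Params} {N : ℕ}

/-! ## §1 The row radius `rS = ⌊⅝M⌋ + L^K` -/

/-- The row radius: `supp h_j ⊆ {|x − Mj| ≤ ⅝M}` enlarged by one `K`-block (`L^K` sites), so that `{|x − Mj| ≤ rS}` carries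
`supp h_j`, its lattice neighbours and every `K`-block meeting it. [cite: Balaban1983RegularityDecay, (2.7) p.576] -/
def rS (P : HiggsLattice.Params) (K K₀ : ℕ) : ℕ := 5 * half P K K₀ / 8 + P.L ^ K

section Arith

variable {K K₀ : ℕ}

/-- `⌊⅝M⌋ + (L^K − 1) ≤ rS` and `⌊⅝M⌋ + 1 ≤ rS`. [cite: Balaban1983RegularityDecay, (2.7) p.576] -/
theorem rH_block_le_rS : 5 * half P K K₀ / 8 + (P.L ^ K - 1) ≤ rS P K K₀ ∧ 5 * half P K K₀ / 8 + 1 ≤ rS P K K₀ := by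
  unfold rS
  have : 1 ≤ P.L ^ K := pow_pos P.hL K
  constructor <;> omega

/-- For `K₀ ≥ 8`: `4·rS ≤ 3M` (so `θ_j = 1` on `{|x − Mj| ≤ rS}`). [cite: Balaban1983RegularityDecay, §2 p.575] -/
theorem four_rS_le (hK₀8 : 8 ≤ K₀) : 4 * rS P K K₀ ≤ 3 * half P K K₀ := by
  unfold rS half
  have h8 : 8 * P.L ^ K ≤ P.L ^ K * K₀ := by
    rw [mul_comm]; exact Nat.mul_le_mul_left _ hK₀8
  omega

/-- For `K₀ ≥ 8`: `rS + 1 < M` (so `{|x − Mj| ≤ rS + 1} ⊆ □_j` and the row multiplicity bound applies).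
[cite: Balaban1983RegularityDecay, §2 p.575] -/
theorem rS_succ_lt_half (hK₀8 : 8 ≤ K₀) : rS P K K₀ + 1 < half P K K₀ := by
  unfold rS half
  have h1 : 1 ≤ P.L ^ K := pow_pos P.hL K
  have h8 : 8 * P.L ^ K ≤ P.L ^ K * K₀ := by
    rw [mul_comm]; exact Nat.mul_le_mul_left _ hK₀8
  omega

/-- `K₀ ≥ 8 ⇒ K₀ ≥ 1`. [folklore] -/
private theorem one_le_of_eight_le (hK₀8 : 8 ≤ K₀) : 1 ≤ K₀ := le_trans (by norm_num) hK₀8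

end Arith

/-! ## §2 The cube configurations `Ã_j = A₀ + θ_jA′`, `A₀ = A(Mj − M)` -/

section CubeField

variable (K K₀ : ℕ)

/-- The lower corner `Mj − M ∈ T_ε` of the cube `□_j` (the image of the box origin under the cube chart).
[cite: Balaban1983RegularityDecay, §2 p.575] -/
def cornerSite (j : Lab P K K₀) : HiggsLattice.Site P 0 := chart K K₀ j 0

/-- **«Ã_j = A₀ + θ_jA′»**, «A₀ is a constant configuration, e.g. A₀ = A(Mj)» — here `A₀ = A(Mj − M)`, the value at
the corner of `□_j` (the choice of the lineage's `B4CubeFields22.cubeField`, whose constant part is the field at the box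
origin): on the bond `b = ⟨x, x + εe_ν⟩`, `Ã_j(b) = A₀,ν + θ_j(x)·(A(b) − A₀,ν)` (`θ_j` read at the initial point, the
component form of p. 575). [cite: Balaban1983RegularityDecay, §2 p.575] -/
def cubeVec (j : Lab P K K₀) (A : HiggsLattice.VecField P 0) : HiggsLattice.VecField P 0 := fun b =>
  A ⟨cornerSite K K₀ j, b.dir⟩ + thetaTor K K₀ j b.src * (A b - A ⟨cornerSite K K₀ j, b.dir⟩)

variable {K K₀}

/-- `Ã_j = A` on bonds starting where `θ_j = 1`. [cite: Balaban1983RegularityDecay, §2 p.575] -/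
theorem cubeVec_apply_of_thetaTor_eq_one {j : Lab P K K₀} {A : HiggsLattice.VecField P 0} {b : HiggsLattice.PBond P 0}
    (h : thetaTor K K₀ j b.src = 1) : cubeVec K K₀ j A b = A b := by
  simp [cubeVec, h]

/-- **`Ã_j(Γ^{(K)}_{y,x}) = A(Γ^{(K)}_{y,x})`** whenever `θ_j = 1` on the `K`-block of `x` (every bond of the composite contour
starts in that block, `B2Ineq329PrismHolonomy.blockIter_stair_src`). [cite: Balaban1983RegularityDecay, (2.6) p.576] -/
theorem multiContourSum_cubeVec {K : ℕ} (hK : K ≤ P.K) {j : Lab P K K₀} {A : HiggsLattice.VecField P 0} {x : HiggsLattice.Site P 0}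
    (hθ : ∀ z : HiggsLattice.Site P 0, blockIter K z = blockIter K x → thetaTor K K₀ j z = 1) :
    multiContourSum (cubeVec K K₀ j A) K x = multiContourSum A K x := by
  have h0 := abs_multiContourSum_le (cubeVec K K₀ j A - A) K x (β := 0) (fun i hi ν s hs => by
    have hb := blockIter_stair_src hi hK x ν hs
    rw [Pi.sub_apply, cubeVec_apply_of_thetaTor_eq_one (hθ _ hb), sub_self, abs_zero])
  rw [mul_zero] at h0
  have h1 : multiContourSum (cubeVec K K₀ j A - A) K x = 0 := abs_nonpos_iff.mp h0
  rwa [multiContourSum_sub, sub_eq_zero] at h1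

end CubeField

/-! ## §3 Pointwise formulas for the pieces of `−Δ^{ε,N}_{A,Ω} + m² + a_k(L^kε)^{−2}P_k(A)` -/

section Pointwise

variable {k : ℕ}

/-- The forward Neumann bond term at a field. [cite: Balaban1982Higgs1, (2.17) p.610] -/
theorem fwdTerm_apply (C : ChargeData N) (Ω : Finset (HiggsLattice.Site P k)) (A : HiggsLattice.VecField P k) (x : HiggsLattice.Site P k) (μ : Fin P.d)
    (φ : HiggsLattice.ScalarField P k N) :
    fwdTerm C Ω A x μ φ
      = if x ∈ Ω ∧ x.shift μ ∈ Ω then φ x - C.U (P.mesh k) (A ⟨x, μ⟩) (φ (x.shift μ)) else 0 := by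
  unfold fwdTerm
  split_ifs <;> simp

/-- The backward Neumann bond term at a field. [cite: Balaban1982Higgs1, (2.17) p.610] -/
theorem bwdTerm_apply (C : ChargeData N) (Ω : Finset (HiggsLattice.Site P k)) (A : HiggsLattice.VecField P k) (x : HiggsLattice.Site P k) (μ : Fin P.d)
    (φ : HiggsLattice.ScalarField P k N) :
    bwdTerm C Ω A x μ φ
      = if x ∈ Ω ∧ x.unshift μ ∈ Ω then φ x - star (C.U (P.mesh k) (A ⟨x.unshift μ, μ⟩)) (φ (x.unshift μ)) else 0 := by
  unfold bwdTerm
  split_ifs <;> simp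

/-- The covariant Neumann Laplacian at a site. [cite: Balaban1982Higgs1, (2.17) p.610] -/
theorem covLaplacianN_apply (C : ChargeData N) (Ω : Finset (HiggsLattice.Site P k)) (A : HiggsLattice.VecField P k) (φ : HiggsLattice.ScalarField P k N)
    (x : HiggsLattice.Site P k) :
    covLaplacianN C Ω A φ x = ((P.mesh k)⁻¹ ^ 2) • ∑ μ : Fin P.d, (fwdTerm C Ω A x μ φ + bwdTerm C Ω A x μ φ) := by
  simp [covLaplacianN, LinearMap.sum_apply]

/-- `P_k(A) = Q_k^*(A)Q_k(A)` at a site: `(P_k(A)φ)(x) = U(A(Γ_{x_k,x}))^* · L^{−kd} Σ_{x′ ∈ B^k(x_k)} U(A(Γ_{x_k,x′})) φ(x′)`.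
[cite: Balaban1982Higgs1, (2.20) p.610] -/
theorem projPk_apply (C : ChargeData N) (A : HiggsLattice.VecField P 0) (k : ℕ) (φ : HiggsLattice.ScalarField P 0 N) (x : HiggsLattice.Site P 0) :
    projPk C A k φ x = star (C.U (P.mesh 0) (multiContourSum A k x))
      ((((P.L : ℝ) ^ (k * P.d))⁻¹) • ∑ x' ∈ blockK k (blockIter k x), C.U (P.mesh 0) (multiContourSum A k x') (φ x')) := by
  have h1 : projPk C A k φ x = star (C.U (P.mesh 0) (multiContourSum A k x)) (avgQkLin C A k φ (blockIter k x)) := by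
    simp [projPk, avgQkAdj]
  rw [h1, avgQkLin_apply, avgQk_apply]

end Pointwise

/-! ## §4 (2.6) on the torus: `H(h_jψ) = H_j(h_jψ)` -/

section Agreement

variable {K K₀ : ℕ}

/-- Sites within `rS + 1` of `Mj` lie in `□_j` (`K₀ ≥ 8`). [cite: Balaban1983RegularityDecay, §2 p.575] -/
theorem mem_cube_of_near_succ (hK₀8 : 8 ≤ K₀) {j : Lab P K K₀} {x : HiggsLattice.Site P 0} (hx : Near K K₀ (rS P K K₀ + 1) j x) :
    x ∈ cube K K₀ j :=
  mem_cube.mpr (inCube_of_near (rS_succ_lt_half hK₀8) hx)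

/-- Sites within `rS` of `Mj` lie in `□_j`, together with their lattice neighbours. [cite: Balaban1983RegularityDecay, §2 p.575] -/
theorem mem_cube_of_near (hK₀8 : 8 ≤ K₀) {j : Lab P K K₀} {x : HiggsLattice.Site P 0} (hx : Near K K₀ (rS P K K₀) j x) (μ : Fin P.d) :
    x ∈ cube K K₀ j ∧ x.shift μ ∈ cube K K₀ j ∧ x.unshift μ ∈ cube K K₀ j :=
  ⟨mem_cube_of_near_succ hK₀8 (near_mono (Nat.le_succ _) hx), mem_cube_of_near_succ hK₀8 (near_shift hx μ),
    mem_cube_of_near_succ hK₀8 (near_unshift hx μ)⟩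

/-- `θ_j = 1` within `rS` of `Mj` (`K₀ ≥ 8`). [cite: Balaban1983RegularityDecay, §2 p.575] -/
theorem thetaTor_eq_one_of_near_rS (hK : K ≤ P.K) (hK₀ : K₀ ∣ P.M) (hK₀8 : 8 ≤ K₀) {j : Lab P K K₀} {x : HiggsLattice.Site P 0}
    (hx : Near K K₀ (rS P K K₀) j x) : thetaTor K K₀ j x = 1 :=
  thetaTor_eq_one_of_near hK hK₀ (one_le_of_eight_le hK₀8) (four_rS_le hK₀8) hx

/-- `supp h_j ⊆ {|x − Mj| ≤ rS}`. [cite: Balaban1983RegularityDecay, (2.7) p.576] -/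
theorem near_rS_of_hTor_ne_zero (hK : K ≤ P.K) (hK₀ : K₀ ∣ P.M) (hK₀8 : 8 ≤ K₀) {j : Lab P K K₀} {x : HiggsLattice.Site P 0}
    (hx : hTor K K₀ j x ≠ 0) : Near K K₀ (rS P K K₀) j x :=
  near_mono (by unfold rS; omega) (near_of_hTor_ne_zero hK hK₀ (one_le_of_eight_le hK₀8) hx)

/-- If `h_j(x + εe_μ) ≠ 0` then `x` is within `rS` of `Mj`. [cite: Balaban1983RegularityDecay, (2.7) p.576] -/
theorem near_rS_of_hTor_shift_ne_zero (hK : K ≤ P.K) (hK₀ : K₀ ∣ P.M) (hK₀8 : 8 ≤ K₀) {j : Lab P K K₀} {x : HiggsLattice.Site P 0}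
    {μ : Fin P.d} (hx : hTor K K₀ j (x.shift μ) ≠ 0) : Near K K₀ (rS P K K₀) j x := by
  have h := near_unshift (near_of_hTor_ne_zero hK hK₀ (one_le_of_eight_le hK₀8) hx) μ
  rw [unshift_shift] at h
  exact near_mono (rH_block_le_rS).2 h

/-- If `h_j(x − εe_μ) ≠ 0` then `x` is within `rS` of `Mj`. [cite: Balaban1983RegularityDecay, (2.7) p.576] -/
theorem near_rS_of_hTor_unshift_ne_zero (hK : K ≤ P.K) (hK₀ : K₀ ∣ P.M) (hK₀8 : 8 ≤ K₀) {j : Lab P K K₀} {x : HiggsLattice.Site P 0}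
    {μ : Fin P.d} (hx : hTor K K₀ j (x.unshift μ) ≠ 0) : Near K K₀ (rS P K K₀) j x := by
  have h := near_shift (near_of_hTor_ne_zero hK hK₀ (one_le_of_eight_le hK₀8) hx) μ
  rw [shift_unshift] at h
  exact near_mono (rH_block_le_rS).2 h

/-- If `h_j(x′) ≠ 0` for some `x′` in the `K`-block of `x`, then `x` is within `rS` of `Mj`.
[cite: Balaban1983RegularityDecay, (2.7) p.576] -/
theorem near_rS_of_block (hK : K ≤ P.K) (hK₀ : K₀ ∣ P.M) (hK₀8 : 8 ≤ K₀) {j : Lab P K K₀} {x x' : HiggsLattice.Site P 0}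
    (hx' : hTor K K₀ j x' ≠ 0) (hb : blockIter K x = blockIter K x') : Near K K₀ (rS P K K₀) j x :=
  near_mono (rH_block_le_rS).1
    (near_of_blockIter_eq hK (near_of_hTor_ne_zero hK hK₀ (one_le_of_eight_le hK₀8) hx') hb)

/-- **(2.6) for the Laplacian**: `−Δ^{ε,N}_{A,T}(h_jψ) = −Δ^{ε,N}_{Ã_j,□_j}(h_jψ)`. [cite: Balaban1983RegularityDecay, (2.6) p.576] -/
theorem covLaplacianN_hTor_agree (C : ChargeData N) (hK : K ≤ P.K) (hK₀ : K₀ ∣ P.M) (hK₀8 : 8 ≤ K₀) (j : Lab P K K₀)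
    (A : HiggsLattice.VecField P 0) (ψ : HiggsLattice.ScalarField P 0 N) :
    covLaplacianN C Finset.univ A (hTor K K₀ j • ψ)
      = covLaplacianN C (cube K K₀ j) (cubeVec K K₀ j A) (hTor K K₀ j • ψ) := by
  funext x
  rw [covLaplacianN_apply, covLaplacianN_apply]
  congr 1
  refine Finset.sum_congr rfl fun μ _ => ?_
  congr 1
  · -- forward bond term
    rw [fwdTerm_apply, fwdTerm_apply, if_pos ⟨Finset.mem_univ _, Finset.mem_univ _⟩]
    by_cases h0 : hTor K K₀ j x = 0 ∧ hTor K K₀ j (x.shift μ) = 0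
    · have e1 : (hTor K K₀ j • ψ) x = 0 := by rw [Pi.smul_apply', h0.1, zero_smul]
      have e2 : (hTor K K₀ j • ψ) (x.shift μ) = 0 := by rw [Pi.smul_apply', h0.2, zero_smul]
      rw [e1, e2]; split_ifs <;> simp
    · have hx : Near K K₀ (rS P K K₀) j x := by
        by_cases h1 : hTor K K₀ j x = 0
        · exact near_rS_of_hTor_shift_ne_zero hK hK₀ hK₀8 (fun h2 => h0 ⟨h1, h2⟩)
        · exact near_rS_of_hTor_ne_zero hK hK₀ hK₀8 h1
      obtain ⟨hc0, hc1, -⟩ := mem_cube_of_near hK₀8 hx μ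
      rw [if_pos ⟨hc0, hc1⟩, cubeVec_apply_of_thetaTor_eq_one (thetaTor_eq_one_of_near_rS hK hK₀ hK₀8 hx)]
  · -- backward bond term
    rw [bwdTerm_apply, bwdTerm_apply, if_pos ⟨Finset.mem_univ _, Finset.mem_univ _⟩]
    by_cases h0 : hTor K K₀ j x = 0 ∧ hTor K K₀ j (x.unshift μ) = 0
    · have e1 : (hTor K K₀ j • ψ) x = 0 := by rw [Pi.smul_apply', h0.1, zero_smul]
      have e2 : (hTor K K₀ j • ψ) (x.unshift μ) = 0 := by rw [Pi.smul_apply', h0.2, zero_smul]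
      rw [e1, e2]; split_ifs <;> simp
    · have hx : Near K K₀ (rS P K K₀) j x := by
        by_cases h1 : hTor K K₀ j x = 0
        · exact near_rS_of_hTor_unshift_ne_zero hK hK₀ hK₀8 (fun h2 => h0 ⟨h1, h2⟩)
        · exact near_rS_of_hTor_ne_zero hK hK₀ hK₀8 h1
      obtain ⟨hc0, -, hc2⟩ := mem_cube_of_near hK₀8 hx μ
      have hxu : Near K K₀ (rS P K K₀) j (x.unshift μ) := by
        by_cases h1 : hTor K K₀ j (x.unshift μ) = 0
        · have h2 : hTor K K₀ j x ≠ 0 := fun h2 => h0 ⟨h2, h1⟩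
          have h3 : hTor K K₀ j ((x.unshift μ).shift μ) ≠ 0 := by rwa [shift_unshift]
          exact near_rS_of_hTor_shift_ne_zero hK hK₀ hK₀8 h3
        · exact near_rS_of_hTor_ne_zero hK hK₀ hK₀8 h1
      rw [if_pos ⟨hc0, hc2⟩, cubeVec_apply_of_thetaTor_eq_one (thetaTor_eq_one_of_near_rS hK hK₀ hK₀8 hxu)]

/-- **(2.6) for `P_K`**: `P_K(A)(h_jψ) = P_K(Ã_j)(h_jψ)` (the contours of a `K`-block meeting `supp h_j` stay where `θ_j = 1`).
[cite: Balaban1983RegularityDecay, (2.6) p.576] -/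
theorem projPk_hTor_agree (C : ChargeData N) (hK : K ≤ P.K) (hK₀ : K₀ ∣ P.M) (hK₀8 : 8 ≤ K₀) (j : Lab P K K₀)
    (A : HiggsLattice.VecField P 0) (ψ : HiggsLattice.ScalarField P 0 N) :
    projPk C A K (hTor K K₀ j • ψ) = projPk C (cubeVec K K₀ j A) K (hTor K K₀ j • ψ) := by
  funext x
  rw [projPk_apply, projPk_apply]
  by_cases hex : ∃ x' ∈ blockK K (blockIter K x), hTor K K₀ j x' ≠ 0
  · obtain ⟨x', hx', hne⟩ := hex
    rw [mem_blockK] at hx'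
    -- `θ_j = 1` on the whole block
    have hθ : ∀ z : HiggsLattice.Site P 0, blockIter K z = blockIter K x → thetaTor K K₀ j z = 1 := fun z hz =>
      thetaTor_eq_one_of_near_rS hK hK₀ hK₀8 (near_rS_of_block hK hK₀ hK₀8 hne (hz.trans hx'.symm))
    rw [multiContourSum_cubeVec hK hθ]
    congr 2
    refine Finset.sum_congr rfl fun x'' hx'' => ?_
    rw [mem_blockK] at hx''
    rw [multiContourSum_cubeVec hK (fun z hz => hθ z (hz.trans hx''))]
  · push Not at hex
    have hz : ∀ x' ∈ blockK K (blockIter K x), (hTor K K₀ j • ψ) x' = 0 := fun x' hx' => by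
      rw [Pi.smul_apply', hex x' hx', zero_smul]
    rw [Finset.sum_eq_zero fun x' hx' => by rw [hz x' hx', map_zero],
      Finset.sum_eq_zero fun x' hx' => by rw [hz x' hx', map_zero]]
    simp

/-- **(2.6) ON THE TORUS for the operator of (2.20)**:
`(−Δ^{ε,N}_{A,T_ε} + m² + a_K(L^Kε)^{−2}P_K(A))(h_jψ) = (−Δ^{ε,N}_{Ã_j,□_j} + m² + a_K(L^Kε)^{−2}P_K(Ã_j))(h_jψ)`.
[cite: Balaban1983RegularityDecay, (2.6) p.576] -/
theorem covOpK_hTor_agree (C : ChargeData N) (hK : K ≤ P.K) (hK₀ : K₀ ∣ P.M) (hK₀8 : 8 ≤ K₀) (j : Lab P K K₀)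
    (A : HiggsLattice.VecField P 0) (msq a : ℝ) (ψ : HiggsLattice.ScalarField P 0 N) :
    covOpK C Finset.univ A msq a K (hTor K K₀ j • ψ)
      = covOpK C (cube K K₀ j) (cubeVec K K₀ j A) msq a K (hTor K K₀ j • ψ) := by
  simp only [covOpK, LinearMap.add_apply, LinearMap.smul_apply, LinearMap.id_apply,
    covLaplacianN_hTor_agree C hK hK₀ hK₀8 j A ψ, projPk_hTor_agree C hK hK₀ hK₀8 j A ψ]

end Agreement

/-! ## §5 The rows of `K_j = [H_j, h_j]` lie within `rS` of `Mj` -/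

section Rows

variable {K K₀ : ℕ}

/-- **Row support of `K_j`** ((2.7): `K_j(x, ·) ≠ 0` only near `supp ∇h_j`): off `{|x − Mj| ≤ rS}` both `(H_j(h_jθ))(x)` and
`h_j(x)` vanish, so `(H_j(h_jθ) − h_jH_jθ)(x) = 0`, for `H_j` the cube operator of (2.20).
[cite: Balaban1983RegularityDecay, (2.7) p.576] -/
theorem commutator_row_zero (C : ChargeData N) (hK : K ≤ P.K) (hK₀ : K₀ ∣ P.M) (hK₀8 : 8 ≤ K₀) (j : Lab P K K₀)
    (A : HiggsLattice.VecField P 0) (msq a : ℝ) (θ : HiggsLattice.ScalarField P 0 N) {x : HiggsLattice.Site P 0} (hx : ¬ Near K K₀ (rS P K K₀) j x) :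
    (covOpK C (cube K K₀ j) (cubeVec K K₀ j A) msq a K (hTor K K₀ j • θ)
      - hTor K K₀ j • covOpK C (cube K K₀ j) (cubeVec K K₀ j A) msq a K θ) x = 0 := by
  have h0 : hTor K K₀ j x = 0 := by
    by_contra h; exact hx (near_rS_of_hTor_ne_zero hK hK₀ hK₀8 h)
  have hsh : ∀ μ, hTor K K₀ j (x.shift μ) = 0 := fun μ => by
    by_contra h; exact hx (near_rS_of_hTor_shift_ne_zero hK hK₀ hK₀8 h)
  have hush : ∀ μ, hTor K K₀ j (x.unshift μ) = 0 := fun μ => by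
    by_contra h; exact hx (near_rS_of_hTor_unshift_ne_zero hK hK₀ hK₀8 h)
  have hbl : ∀ x' ∈ blockK K (blockIter K x), hTor K K₀ j x' = 0 := fun x' hx' => by
    by_contra h
    rw [mem_blockK] at hx'
    exact hx (near_rS_of_block hK hK₀ hK₀8 h hx'.symm)
  rw [Pi.sub_apply, Pi.smul_apply', h0, zero_smul, sub_zero]
  simp only [covOpK, LinearMap.add_apply, LinearMap.smul_apply, LinearMap.id_apply, Pi.add_apply, Pi.smul_apply]
  have e0 : (hTor K K₀ j • θ) x = 0 := by rw [Pi.smul_apply', h0, zero_smul]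
  have eL : covLaplacianN C (cube K K₀ j) (cubeVec K K₀ j A) (hTor K K₀ j • θ) x = 0 := by
    rw [covLaplacianN_apply]
    refine smul_eq_zero_of_right _ (Finset.sum_eq_zero fun μ _ => ?_)
    have e1 : (hTor K K₀ j • θ) (x.shift μ) = 0 := by rw [Pi.smul_apply', hsh μ, zero_smul]
    have e2 : (hTor K K₀ j • θ) (x.unshift μ) = 0 := by rw [Pi.smul_apply', hush μ, zero_smul]
    rw [fwdTerm_apply, bwdTerm_apply, e0, e1, e2]
    split_ifs <;> simp
  have eP : projPk C (cubeVec K K₀ j A) K (hTor K K₀ j • θ) x = 0 := by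
    rw [projPk_apply, Finset.sum_eq_zero fun x' hx' => by rw [Pi.smul_apply', hbl x' hx', zero_smul, map_zero]]
    simp
  rw [eL, e0, eP, smul_zero, smul_zero, add_zero, add_zero]

end Rows

/-! ## §6 THEOREM (1.10) (value member, sup form) on `T_ε`, modulo the cube inputs -/

section Torus

variable {K K₀ : ℕ}

/-- **THEOREM (1.10), VALUE MEMBER, SUP-NORM FORM, ON THE TORUS `Ω = T_ε` — modulo the cube inputs.**  Let `m² > 0`,
`a_K ≥ 0`, `K ≤ K_P`, `K₀ ∣ M_P`, `K₀ ≥ 8`, and let `A` be ANY vector field on `T_ε`.  Suppose every cube Green's function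
`G_j = G^ε_K(□_j, Ã_j)` ((2.20) on `□_j` with Neumann conditions and the cube configuration `Ã_j`) satisfies
`‖G_j(h_jψ)‖_∞ ≤ γ‖ψ‖_∞` and `‖(H_jh_j − h_jH_j)G_j(h_jψ)‖_∞ ≤ β‖ψ‖_∞` with `2^d·β ≤ ½` ((2.17), (2.20): on the unit
lattice γ = O(1)·(L^Kε)², β = O(1)·M^{−κ}).  Then `‖G^ε_K(T_ε, A)φ‖_∞ ≤ 2·2^d·γ·‖φ‖_∞` — the random-walk expansion
(2.9)–(2.12) with `Σ_j h_j² = 1`, (2.6) and the row multiplicity `2^d` of the cube cores.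
[cite: Balaban1983RegularityDecay, Theorem (1.10) p.573; (2.9)–(2.12) pp.576–577] -/
theorem norm_propagatorK_univ_le (C : ChargeData N) (hK : K ≤ P.K) (hK₀ : K₀ ∣ P.M) (hK₀8 : 8 ≤ K₀) {msq : ℝ}
    (hmsq : 0 < msq) (a : ℝ) (hak : 0 ≤ B1.aSeq a P.L K) (A : HiggsLattice.VecField P 0) {γ β : ℝ} (hγ : 0 ≤ γ) (hβ : 0 ≤ β)
    (hGj : ∀ (j : Lab P K K₀) (ψ : HiggsLattice.ScalarField P 0 N),
      ‖propagatorK C (cube K K₀ j) (cubeVec K K₀ j A) msq a K (hTor K K₀ j • ψ)‖ ≤ γ * ‖ψ‖)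
    (hKj : ∀ (j : Lab P K K₀) (ψ : HiggsLattice.ScalarField P 0 N),
      ‖covOpK C (cube K K₀ j) (cubeVec K K₀ j A) msq a K
          (hTor K K₀ j • propagatorK C (cube K K₀ j) (cubeVec K K₀ j A) msq a K (hTor K K₀ j • ψ))
        - hTor K K₀ j • covOpK C (cube K K₀ j) (cubeVec K K₀ j A) msq a K
          (propagatorK C (cube K K₀ j) (cubeVec K K₀ j A) msq a K (hTor K K₀ j • ψ))‖ ≤ β * ‖ψ‖)
    (hsmall : (2 : ℝ) ^ P.d * β ≤ 1 / 2) (φ : HiggsLattice.ScalarField P 0 N) :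
    ‖propagatorK C Finset.univ A msq a K φ‖ ≤ 2 * 2 ^ P.d * γ * ‖φ‖ := by
  classical
  have hK₀' : 1 ≤ K₀ := one_le_of_eight_le hK₀8
  have h := norm_inverse_apply_le_of_isUnit (X := HiggsLattice.Site P 0) (E := EuclideanSpace ℝ (Fin N)) (J := Lab P K K₀)
    (covOpK C Finset.univ A msq a K) (isUnit_covOpK C Finset.univ A hmsq a K hak)
    (fun j => covOpK C (cube K K₀ j) (cubeVec K K₀ j A) msq a K)
    (fun j => propagatorK C (cube K K₀ j) (cubeVec K K₀ j A) msq a K)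
    (fun j => covOpK_mul_propagatorK C (cube K K₀ j) (cubeVec K K₀ j A) hmsq a K hak)
    (hTor K K₀) (sum_hTor_sq hK hK₀ hK₀') (abs_hTor_le_one hK hK₀ hK₀')
    (fun j ψ => covOpK_hTor_agree C hK hK₀ hK₀8 j A msq a ψ)
    (fun j => Finset.univ.filter (Near K K₀ (rS P K K₀) j))
    (fun j x hx => by
      rw [Finset.mem_filter]; exact ⟨Finset.mem_univ _, near_rS_of_hTor_ne_zero hK hK₀ hK₀8 hx⟩)
    (fun j θ x hx => commutator_row_zero C hK hK₀ hK₀8 j A msq a θ (fun h => hx (by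
      rw [Finset.mem_filter]; exact ⟨Finset.mem_univ _, h⟩)))
    (2 ^ P.d)
    (fun x => by
      have e : (Finset.univ.filter fun j : Lab P K K₀ => x ∈ Finset.univ.filter (Near K K₀ (rS P K K₀) j))
          = Finset.univ.filter fun j : Lab P K K₀ => Near K K₀ (rS P K K₀) j x := by
        ext j'; simp
      rw [e]
      exact card_filter_near_le hK hK₀ hK₀' (lt_trans (Nat.lt_succ_self _) (rS_succ_lt_half hK₀8)) x)
    hγ hβ hGj hKj (by push_cast; exact hsmall) φ
  have e2 : ((2 ^ P.d : ℕ) : ℝ) = 2 ^ P.d := by push_cast; ring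
  rw [e2] at h
  exact h

end Torus

end Literature.MathematicalPhysics.QuantumFieldTheory.Balaban1983to89.B1TorusCubeLocality26
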